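import Literature.NumberTheory.GelbartRogawski1991.LocalUnitarySplittingDatum
import Literature.NumberTheory.Automorphic.Liu2021.LemD1DataOfPlace
import HarnessLib

/-!
# The rank-one theta lift remembers the character: `Θ(χ) ≅ Θ(χ') ≠ 0 ⇒ χ = χ'` (central characters)

Topic `RepresentationTheory/MoeglinVignerasWaldspurger1987`; THEOREMS ONLY (no definition, no named fact).  Companion
of `RankOneThetaLift.lean` (the three named facts IV-1/IV-2 of the Hodge/COR-CM interface at the tree's honest local
Weil representation `ω_s = (MpPsi.toRep (localSchrodinger F N T v)).comp s` of `U(J)(F_v)`).  For the RANK-ONE dual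
pair `(U(W), U(V))`, `dim_E W = 1`, the member `U(W) = E_v¹` acts on `Res(V ⊗ W)` through the CENTRE of `U(V)`
(the tree's `UnitaryGroup.localCenter … : U(J₁)(F_v) →* U(J)(F_v)`), so the `χ`-coinvariants
`Θ(χ) = TwistedCoinv.Coinv (ω_s ∘ centre) χ` carry the `U(J)(F_v)`-representation `TwistedCoinv.rep χ ω_s _` on which
the centre acts by `χ` (`TwistedCoinv.rep_eq_smul_of_forall`).  CONSEQUENCE PROVED HERE: **if `Θ(χ) ≠ 0` and
`Θ(χ) ≅ Θ(χ')` as representations of `U(J)(F_v)` (`AreIsomorphicRep`, the currency of [Liu2021, Lem. D.1 (2)–(4)]),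
then `χ = χ'`** — the `χ`-clause of [Liu2021, App. D, Lem. D.1 (3)] («if `n ≥ 3`, then `ω(μ', ε', χ')` is
isomorphic to `ω(μ, ε, χ)` if and only if `(μ', ε', χ') = (μ, ε, χ)`», l. 5233) at equal `(μ, ε)`, which is also
the injectivity half of Howe duality for this pair ([GanTakeda2015, Thm. 1.2]: «(ii) If `θ(π) = θ(π') ≠ 0`, then
`π = π'`», p. 473) — obtained here for ANY `N` and any homomorphism `s`, with no irreducibility, from the generic
centre lemma `TwistedCoinv.char_apply_eq_of_intertwiner` (`TwistedCoinvariants.lean`).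

* §1 (generic, namespace `Literature.RepresentationTheory.TwistedCoinv`): `char_eq_of_linearEquiv` — for commuting
  `ρV : G → GL(S)`, `ρW : H → GL(S)` and a map `ζ : H → G` with `ρV (ζ w) = ρW w`, a `ζ(H)`-equivariant linear
  equivalence `Coinv ρW χ ≃ Coinv ρW χ'` with `Coinv ρW χ ≠ 0` forces `χ = χ'`.
* §2 (namespace `Literature.RepresentationTheory.MoeglinVignerasWaldspurger1987`):
  `rankOne_thetaChar_eq_of_areIsomorphicRep` — the instantiation at `ω_s`, `UnitaryGroup.localCenter`,
  `AreIsomorphicRep`.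

## References
* [Liu2021] Y. Liu, Camb. J. Math. 9 (2021) = arXiv:2102.11518, App. D Lem. D.1 (3) (FJcycle.tex l. 5233).
* [GanTakeda2015] W. T. Gan, S. Takeda, *A proof of the Howe duality conjecture*, J. AMS 29 (2016) 473–493,
  Thm. 1.2 and §1 (ii) p. 473.
* [MoeglinVignerasWaldspurger1987] MVW, LNM 1291, Chap. 3 §IV (rank-one type I pairs).
-/

noncomputable section

/-! ## §1 Generic: an equivariant isomorphism of twisted coinvariant spaces preserves the character -/

namespace Literature.RepresentationTheory.TwistedCoinv

variable {k : Type*} [Field k] {G H S : Type*} [Group G] [Group H] [AddCommGroup S] [Module k S]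
variable {ρW : Representation k H S} (χ χ' : H →* kˣ) (ρV : Representation k G S)

/-- **The character is an invariant of the coinvariant representation.**  Let `ρV`, `ρW` commute and let
`ζ : H → G` satisfy `ρV (ζ w) = ρW w` (the second group acts through elements of the first — the common centre of a
rank-one dual pair).  If `Coinv ρW χ ≠ 0` and there is a linear equivalence `Coinv ρW χ ≃ Coinv ρW χ'` intertwining
the action of every `ζ w`, then `χ = χ'`: `ζ w` acts by `χ w` on the source and by `χ' w` on the target
(`rep_eq_smul_of_forall`), and an isomorphism has a non-zero value (`char_apply_eq_of_intertwiner`).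
[cite: Liu2021, App. D Lemma D.1 (3) (l. 5233)] -/
theorem char_eq_of_linearEquiv (hc : ∀ (g : G) (h : H), Commute (ρV g) (ρW h)) (ζ : H → G)
    (hζ : ∀ (w : H) (v : S), ρV (ζ w) v = ρW w v) [Nontrivial (Coinv ρW χ)]
    (f : Coinv ρW χ ≃ₗ[k] Coinv ρW χ')
    (hf : ∀ (w : H) (x : Coinv ρW χ), f (rep χ ρV hc (ζ w) x) = rep χ' ρV hc (ζ w) (f x)) : χ = χ' := by
  obtain ⟨x, hx⟩ := exists_ne (0 : Coinv ρW χ)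
  refine MonoidHom.ext fun w => ?_
  exact char_apply_eq_of_intertwiner χ χ' ρV hc one_ne_zero (fun v => by rw [one_smul]; exact hζ w v)
    f.toLinearMap (hf w) (x := x) (by simpa using hx)

end Literature.RepresentationTheory.TwistedCoinv

/-! ## §2 The rank-one unitary theta lift at the tree's local Weil representation -/

namespace Literature.RepresentationTheory.MoeglinVignerasWaldspurger1987

open NumberField IsDedekindDomain
open Literature.RepresentationTheory.HeisenbergGroup (MpPsi)
open Literature.NumberTheory.GelbartRogawski1991.UnitaryDualPair.LocalSplitting (LocalMp localSchrodinger)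
open Literature.NumberTheory.Automorphic (SchwartzBruhat UnitaryGroup.localPi UnitaryGroup.localCenter
  UnitaryGroup.localCenter_comm)
open Literature.NumberTheory.Automorphic.Liu2021 (AreIsomorphicRep)

/-- **`Θ(χ) ≅ Θ(χ') ≠ 0 ⇒ χ = χ'` for the rank-one pair `(U(W), U(V))`, `dim W = 1`**, at the tree's objects: for ANY
homomorphism `s : U(J)(F_v) →* S̃p_ψ` (in particular any local splitting), `ω_s := (MpPsi.toRep (localSchrodinger F N T v))
∘ s`, the centre `U(J₁)(F_v) → U(J)(F_v)` (`UnitaryGroup.localCenter`), and two characters `χ, χ'` of `U(J₁)(F_v) = E_v¹`: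
if the `χ`-coinvariants are non-zero and the coinvariant representations of `U(J)(F_v)` are isomorphic
(`AreIsomorphicRep`), then `χ = χ'` — the `χ`-clause of [Liu2021, Lem. D.1 (3)] at fixed `(μ, ε)`, i.e. the
injectivity (ii) of Howe duality [GanTakeda2015, Thm. 1.2] for this pair, by central characters.
[cite: Liu2021, App. D Lemma D.1 (3) (l. 5233)] -/
theorem rankOne_thetaChar_eq_of_areIsomorphicRep (F : Type) [Field F] [NumberField F] (E : Type) [Field E]
    [NumberField E] [Algebra F E] (c : E ≃ₐ[F] E) (N : ℕ) (T : Matrix (Fin N) (Fin N) F)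
    (J : Matrix (Fin N) (Fin N) E) (v : HeightOneSpectrum (𝓞 F))
    (s : UnitaryGroup.localPi E c N J v →* LocalMp F N T v)
    (J₁ : Matrix (Fin 1) (Fin 1) E) (hJ₁ : J₁ 0 0 ≠ 0) (χ χ' : UnitaryGroup.localPi E c 1 J₁ v →* ℂˣ)
    (hnt : Nontrivial (TwistedCoinv.Coinv
      ((show Representation ℂ (UnitaryGroup.localPi E c 1 J₁ v) (SchwartzBruhat (Fin N → v.adicCompletion F)) from
        ((MpPsi.toRep (localSchrodinger F N T v)).comp s).comp (UnitaryGroup.localCenter E c N J J₁ hJ₁ v))) χ))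
    (hiso : AreIsomorphicRep
      (TwistedCoinv.rep (ρW := show Representation ℂ (UnitaryGroup.localPi E c 1 J₁ v)
          (SchwartzBruhat (Fin N → v.adicCompletion F)) from
          ((MpPsi.toRep (localSchrodinger F N T v)).comp s).comp (UnitaryGroup.localCenter E c N J J₁ hJ₁ v)) χ
        ((MpPsi.toRep (localSchrodinger F N T v)).comp s)
        (fun g z => (show Commute g (UnitaryGroup.localCenter E c N J J₁ hJ₁ v z) from
          UnitaryGroup.localCenter_comm E c N J J₁ hJ₁ v z g).map ((MpPsi.toRep (localSchrodinger F N T v)).comp s)))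
      (TwistedCoinv.rep (ρW := show Representation ℂ (UnitaryGroup.localPi E c 1 J₁ v)
          (SchwartzBruhat (Fin N → v.adicCompletion F)) from
          ((MpPsi.toRep (localSchrodinger F N T v)).comp s).comp (UnitaryGroup.localCenter E c N J J₁ hJ₁ v)) χ'
        ((MpPsi.toRep (localSchrodinger F N T v)).comp s)
        (fun g z => (show Commute g (UnitaryGroup.localCenter E c N J J₁ hJ₁ v z) from
          UnitaryGroup.localCenter_comm E c N J J₁ hJ₁ v z g).map ((MpPsi.toRep (localSchrodinger F N T v)).comp s)))) :
    χ = χ' := by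
  haveI := hnt
  obtain ⟨f, hf⟩ := hiso
  exact TwistedCoinv.char_eq_of_linearEquiv χ χ' ((MpPsi.toRep (localSchrodinger F N T v)).comp s) _
    (UnitaryGroup.localCenter E c N J J₁ hJ₁ v) (fun _ _ => rfl) f (fun w x => hf _ x)

end Literature.RepresentationTheory.MoeglinVignerasWaldspurger1987

end
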